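import Literature.AlgebraicGeometry.Deformation.PointedSchemeTangentSpaceClosedPoint
import Literature.AlgebraicGeometry.Deformation.TangentSpaceOfPoints
import HarnessLib

/-!
# The tangent space of a pointed `K`-scheme is `(𝔪_x/𝔪_x²)^∨` AS A `K`-VECTOR SPACE
# ([GortzWedhorn2020] Prop. 6.7 with [Schlessinger1968] Lemma 2.10's structure on `X(K[ε])_x`)

Layer `Literature/AlgebraicGeometry/Deformation`, namespace `Literature.AlgebraicGeometry.Deformation`.  DEFINITIONS WITH
BODY (a base point, a `LinearEquiv`) and theorems; no named fact, no instance, no notation.  Sequel of ★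
`Deformation/PointedSchemeFunctorOfPoints` (the SET-level `dualNumberPointsOverAtEquivDual : X(K[ε])_x ≃ (𝔪_x/𝔪_x²)^∨` and
the comparison `pointedSchemeFunctorToPoints : (X, x)`'s functor of points on `Art_K` `→ h_{𝒪_{X,x}}`, natural and
bijective) and of the Schlessinger frame ★ `Deformation/TangentSpaceVectorSpace` / `TangentSpaceOfPoints` (Lemma 2.10's
`K`-module `ArtinFunctor.tangentModule` on `F(K[V])`, `natTangentLinearMap`, `ArtinFunctor.pointsTangentEquivCotangentDual :
t_{h_R} ≃ₗ[K] (I/I²)^∨`).  Here the two are joined: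

* §1 `ArtinFunctor.IsBijectiveAlong.of_isNatural_bijective` — «(2.12) is a bijection along `p`» transfers along a
  natural, componentwise bijective family `ν : F → G` (generic; [Schlessinger1968, (2.12)]); `ArtinFunctor.natTangentLinearEquiv`
  — such a `ν` induces a LINEAR ISO of tangent spaces ([Manetti1999DeformationTheoryDGLA, Prop. 2.6]);
* §2 `pointedSchemeFunctor_isBijectiveAlong` — `(X, x)`'s functor of points satisfies (2.12)-bijectivity along every
  SURJECTION of `Art_K` (transfer from `h_{𝒪_{X,x}}`, ★ `ArtinFunctor.points_H4`), in particular (H₂)/(H₄);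
  `pointedSchemeFunctor_base_eq` — its value on `K` is a point (≤ 1 element: `augmentation_unique`);
  `basePointOfAugmentation π` — the `K`-point through a `K`-rational `x`;
* §3 **`tangentLinearEquivDual F x π : (pointedSchemeFunctor F x).obj K[ε] ≃ₗ[K] Module.Dual K (CotangentSpace 𝒪_{X,x})`**
  for Lemma 2.10's `K`-module structure on the left ([GortzWedhorn2020] Prop. 6.7: «isomorphism of `k`-vector spaces
  `T_x X ≅ X(k[ε])_x`», the vector-space structure on `X(k[ε])_x` being the functorial one, (6.4)), and
  `tangentLinearEquivDual_apply` — on points it IS the set-level `dualNumberPointsOverAtEquivDual`; `finrank_tangent_eq` —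
  **`dim_K X(K[ε])_x = dim_{κ(x)} 𝔪_x/𝔪_x²`** (with ★ `PointedSchemeTangentSpaceClosedPoint.finrank_dual_cotangentSpace_eq`).

* §4 THE E1 JUNCTION (E6 of `B-plan/F-census/SOCKETS-F.md` §4 (α)): for ANY functor of Artin rings `D` naturally bijective
  with `(X, x)`'s functor of points (E1-mod: `D = Def_{(A₀,λ₀,η₀)}`), **`tangentLinearEquivDualOfNatural : t_D ≃ₗ[K]
  (𝔪_x/𝔪_x²)^∨`** and **`finrank_tangent_eq_of_isNatural : dim_K t_D = dim_{κ(x)} 𝔪_x/𝔪_x²`**.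
Cell `hodgecm-mathlib` (D-0151); count-neutral.  HC_CM is proved only modulo the 7 printed citations until rung 0 closes.

## References
* [GortzWedhorn2020] U. Görtz, T. Wedhorn, *Algebraic Geometry I* (2nd ed. 2020): (6.4), Prop. 6.7.
* [Schlessinger1968] M. Schlessinger, Functors of Artin rings, Trans. AMS 130 (1968): (2.6), Lemma 2.10, (2.12), Thm. 2.11.
* [Manetti1999DeformationTheoryDGLA] M. Manetti, Deformation theory via DGLA (1999): Prop. 2.6.
-/

set_option autoImplicit false

noncomputable section
universe u

open CategoryTheory AlgebraicGeometry IsLocalRing Literature.RingTheory.CompleteLocalRings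

namespace Literature.AlgebraicGeometry.Deformation

/-! ## §1 Transfer of «(2.12) is a bijection» along a natural bijection of functors of Artin rings -/

section Transfer

variable {k : Type u} [Field k] {F G : ArtinFunctor.{u} k} (ν : ∀ R : ArtAlg.{u} k, F.obj R → G.obj R)

/-- **«(2.12) is a bijection along `p`» transfers along a natural, componentwise bijective `ν : F → G`** (from `G` to
`F`: lift in `G`, pull the lift back through the bijection `ν`, and compare images under the injective `ν`).
[cite: Schlessinger1968, Thm. 2.11 and (2.12), p. 212] -/
theorem ArtinFunctor.IsBijectiveAlong.of_isNatural_bijective (hν : F.IsNatural G ν)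
    (hb : ∀ R, Function.Bijective (ν R)) {R₀ R₁ : ArtAlg.{u} k} (p : R₁ →ₐ[k] R₀) (hG : G.IsBijectiveAlong p) :
    F.IsBijectiveAlong p := by
  intro R₂ R₃ q q' p' hc
  obtain ⟨hlift, huniq⟩ := hG q q' p' hc
  refine ⟨fun y z hyz => ?_, fun w w' hq hp => ?_⟩
  · have hyz' : G.map p (ν R₁ y) = G.map q (ν R₂ z) := by rw [← hν, ← hν, hyz]
    obtain ⟨w', hw'₁, hw'₂⟩ := hlift (ν R₁ y) (ν R₂ z) hyz'
    obtain ⟨w, rfl⟩ := (hb R₃).2 w'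
    refine ⟨w, (hb R₁).1 ?_, (hb R₂).1 ?_⟩
    · rw [hν, hw'₁]
    · rw [hν, hw'₂]
  · apply (hb R₃).1
    refine huniq _ _ ?_ ?_
    · rw [← hν, ← hν, hq]
    · rw [← hν, ← hν, hp]


/-- **A natural, componentwise BIJECTIVE `ν : F → G` induces a LINEAR ISOMORPHISM of tangent spaces `t_F(V) ≃ₗ t_G(V)`**
for [Schlessinger1968, Lemma 2.10]'s structures ([Manetti1999DeformationTheoryDGLA, Prop. 2.6]: the induced map is linear;
bijective by hypothesis). Definition with body (`LinearEquiv.ofBijective` of ★ `ArtinFunctor.natTangentLinearMap`).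
[cite: Schlessinger1968, Lemma 2.10, p. 212] [cite: Manetti1999DeformationTheoryDGLA, Prop. 2.6] -/
def ArtinFunctor.natTangentLinearEquiv (hν : F.IsNatural G ν) (hb : ∀ R, Function.Bijective (ν R))
    (ptF : F.obj (ArtAlg.base k)) (hptF : ∀ a, a = ptF) (ptG : G.obj (ArtAlg.base k)) (hptG : ∀ a, a = ptG)
    (V : Type u) [AddCommGroup V] [Module k V] [Module kᵐᵒᵖ V] [IsCentralScalar k V] [Module.Finite k V]
    (hVF : F.IsBijectiveAlong (ArtAlg.sqZeroExtAug (k := k) V)) (hVG : G.IsBijectiveAlong (ArtAlg.sqZeroExtAug (k := k) V)) :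
    letI := F.tangentAddCommGroup ptF hptF V hVF; letI := F.tangentModule ptF hptF V hVF
    letI := G.tangentAddCommGroup ptG hptG V hVG; letI := G.tangentModule ptG hptG V hVG
    F.obj (ArtAlg.sqZeroExt (k := k) V) ≃ₗ[k] G.obj (ArtAlg.sqZeroExt (k := k) V) :=
  letI := F.tangentAddCommGroup ptF hptF V hVF; letI := F.tangentModule ptF hptF V hVF
  letI := G.tangentAddCommGroup ptG hptG V hVG; letI := G.tangentModule ptG hptG V hVG
  LinearEquiv.ofBijective (ArtinFunctor.natTangentLinearMap ν hν ptF hptF ptG hptG hVF hVG) (hb _)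

/-- `ArtinFunctor.natTangentLinearEquiv` is `ν` on points (by `rfl`). [cite: Schlessinger1968, Lemma 2.10, p. 212] -/
theorem ArtinFunctor.natTangentLinearEquiv_apply (hν : F.IsNatural G ν) (hb : ∀ R, Function.Bijective (ν R))
    (ptF : F.obj (ArtAlg.base k)) (hptF : ∀ a, a = ptF) (ptG : G.obj (ArtAlg.base k)) (hptG : ∀ a, a = ptG)
    (V : Type u) [AddCommGroup V] [Module k V] [Module kᵐᵒᵖ V] [IsCentralScalar k V] [Module.Finite k V]
    (hVF : F.IsBijectiveAlong (ArtAlg.sqZeroExtAug (k := k) V)) (hVG : G.IsBijectiveAlong (ArtAlg.sqZeroExtAug (k := k) V))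
    (y : F.obj (ArtAlg.sqZeroExt (k := k) V)) :
    letI := F.tangentAddCommGroup ptF hptF V hVF; letI := F.tangentModule ptF hptF V hVF
    letI := G.tangentAddCommGroup ptG hptG V hVG; letI := G.tangentModule ptG hptG V hVG
    ArtinFunctor.natTangentLinearEquiv ν hν hb ptF hptF ptG hptG V hVF hVG y = ν _ y :=
  rfl

end Transfer

/-! ## §2 `(X, x)`'s functor of points: (2.12)-bijectivity along surjections; the base point -/

variable {K : Type u} [Field K] {X : Scheme.{u}} (F : X ⟶ Spec (.of K)) (x : X)

/-- **`(X, x)`'s functor of points on `Art_K` satisfies «(2.12) is a bijection» along every surjection** (hence (H₂) and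
(H₄)): transfer from `h_{𝒪_{X,x}}` (★ `ArtinFunctor.points_H4`) along the natural bijection `pointedSchemeFunctorToPoints`.
[cite: Schlessinger1968, Thm. 2.11 (2) and (2.12), p. 212] [cite: GortzWedhorn2020, (6.4) Prop. 6.7] -/
theorem pointedSchemeFunctor_isBijectiveAlong {R₀ R₁ : ArtAlg.{u} K} (p : R₁ →ₐ[K] R₀) (hp : Function.Surjective p) :
    (pointedSchemeFunctor F x).IsBijectiveAlong p :=
  letI := (stalkAlgebraMap F x).toAlgebra
  ArtinFunctor.IsBijectiveAlong.of_isNatural_bijective (pointedSchemeFunctorToPoints F x)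
    (isNatural_pointedSchemeFunctorToPoints F x) (pointedSchemeFunctorToPoints_bijective F x) p
    ((ArtinFunctor.points (k := K) (X.presheaf.stalk x)).isBijectiveAlong_of_H4 (ArtinFunctor.points_H4 _) p hp)

/-- **`(X, x)`'s functor of points takes the value «a point» on `K`**: two `K`-points through `x` over `K` coincide (their
local `K`-algebra maps are augmentations of `𝒪_{X,x}`, `augmentation_unique`). [cite: GortzWedhorn2020, (6.4) Prop. 6.7] -/
theorem pointedSchemeFunctor_base_eq (pt a : (pointedSchemeFunctor F x).obj (ArtAlg.base K)) : a = pt := by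
  letI := (stalkAlgebraMap F x).toAlgebra
  apply (pointedSchemeFunctorToPoints_bijective F x (ArtAlg.base K)).1
  exact augmentation_unique _ _

/-- The `K`-point of `X` through a `K`-RATIONAL `x` (rationality = an augmentation `π : 𝒪_{X,x} →ₐ[K] K`), as the base point
of `(X, x)`'s functor of points. [cite: GortzWedhorn2020, (6.4) Prop. 6.7 and Exercise 3.18] -/
def basePointOfAugmentation (π : letI := (stalkAlgebraMap F x).toAlgebra; X.presheaf.stalk x →ₐ[K] K) :
    (pointedSchemeFunctor F x).obj (ArtAlg.base K) :=
  letI := (stalkAlgebraMap F x).toAlgebra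
  (pointsOverAtEquiv F x K).symm ⟨π, isLocalHom_of_augmentation (AlgHom.id K K) π⟩

/-! ## §3 The tangent space `X(K[ε])_x ≃ₗ[K] (𝔪_x/𝔪_x²)^∨` -/

/-- **[GortzWedhorn2020, Prop. 6.7] as an isomorphism of `K`-VECTOR SPACES**: for a `K`-rational point (augmentation `π`),
`X(K[ε])_x = (pointedSchemeFunctor F x)(K[ε])` with [Schlessinger1968, Lemma 2.10]'s `K`-module structure is LINEARLY
isomorphic to `Module.Dual K (𝔪_x/𝔪_x²)` — the linear map of tangent spaces induced by the morphism of functors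
`pointedSchemeFunctorToPoints` ([Manetti1999DeformationTheoryDGLA, Prop. 2.6], ★ `ArtinFunctor.natTangentLinearMap`), bijective,
followed by ★ `ArtinFunctor.pointsTangentEquivCotangentDual : t_{h_{𝒪_{X,x}}} ≃ₗ[K] (ker π/(ker π)²)^∨` and `ker π = 𝔪_x`.
[cite: GortzWedhorn2020, (6.4) Prop. 6.7] [cite: Schlessinger1968, (2.6) p. 211 and Lemma 2.10 p. 212] -/
def tangentLinearEquivDual (π : letI := (stalkAlgebraMap F x).toAlgebra; X.presheaf.stalk x →ₐ[K] K) :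
    letI := (stalkAlgebraMap F x).toAlgebra
    letI := (pointedSchemeFunctor F x).tangentAddCommGroup (basePointOfAugmentation F x π)
      (pointedSchemeFunctor_base_eq F x _) K
      (pointedSchemeFunctor_isBijectiveAlong F x _ (ArtAlg.sqZeroExtAug_surjective K))
    letI := (pointedSchemeFunctor F x).tangentModule (basePointOfAugmentation F x π)
      (pointedSchemeFunctor_base_eq F x _) K
      (pointedSchemeFunctor_isBijectiveAlong F x _ (ArtAlg.sqZeroExtAug_surjective K))
    (pointedSchemeFunctor F x).obj (ArtAlg.sqZeroExt (k := K) K) ≃ₗ[K] Module.Dual K (CotangentSpace (X.presheaf.stalk x)) :=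
  letI := (stalkAlgebraMap F x).toAlgebra
  letI := (pointedSchemeFunctor F x).tangentAddCommGroup (basePointOfAugmentation F x π)
    (pointedSchemeFunctor_base_eq F x _) K
    (pointedSchemeFunctor_isBijectiveAlong F x _ (ArtAlg.sqZeroExtAug_surjective K))
  letI := (pointedSchemeFunctor F x).tangentModule (basePointOfAugmentation F x π)
    (pointedSchemeFunctor_base_eq F x _) K
    (pointedSchemeFunctor_isBijectiveAlong F x _ (ArtAlg.sqZeroExtAug_surjective K))
  letI := (ArtinFunctor.points (k := K) (X.presheaf.stalk x)).tangentAddCommGroup π (fun a => augmentation_unique a π) K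
    (ArtinFunctor.points_isBijectiveAlong_sqZeroExtAug (X.presheaf.stalk x) K)
  letI := (ArtinFunctor.points (k := K) (X.presheaf.stalk x)).tangentModule π (fun a => augmentation_unique a π) K
    (ArtinFunctor.points_isBijectiveAlong_sqZeroExtAug (X.presheaf.stalk x) K)
  (LinearEquiv.ofBijective
    (ArtinFunctor.natTangentLinearMap (pointedSchemeFunctorToPoints F x) (isNatural_pointedSchemeFunctorToPoints F x)
      (basePointOfAugmentation F x π) (pointedSchemeFunctor_base_eq F x _) π (fun a => augmentation_unique a π)
      (pointedSchemeFunctor_isBijectiveAlong F x _ (ArtAlg.sqZeroExtAug_surjective K))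
      (ArtinFunctor.points_isBijectiveAlong_sqZeroExtAug (X.presheaf.stalk x) K))
    (pointedSchemeFunctorToPoints_bijective F x _)).trans <|
  (ArtinFunctor.pointsTangentEquivCotangentDual (X.presheaf.stalk x) π (fun a => augmentation_unique a π)).trans
    ((Ideal.Cotangent.equivOfEq _ _ (TangentHom.ker_eq_maximalIdeal π)).restrictScalars K).symm.dualMap

/-- **On points, `tangentLinearEquivDual` IS the set-level bijection `dualNumberPointsOverAtEquivDual`** of ★
`PointedSchemeFunctorOfPoints` (`(pointedSchemeFunctor F x)(K[ε]) = PointsOverAt F x K[ε]` by `rfl`): the value on `t` at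
the class of `s ∈ 𝔪_x` is the `ε`-part of the local homomorphism of `t` at `s`. [cite: GortzWedhorn2020, (6.4) Prop. 6.7] -/
theorem tangentLinearEquivDual_apply (π : letI := (stalkAlgebraMap F x).toAlgebra; X.presheaf.stalk x →ₐ[K] K)
    (t : PointsOverAt F x (DualNumber K)) :
    letI := (stalkAlgebraMap F x).toAlgebra
    (tangentLinearEquivDual F x π : PointsOverAt F x (DualNumber K) → _) t = dualNumberPointsOverAtEquivDual F x π t := by
  letI := (stalkAlgebraMap F x).toAlgebra
  refine LinearMap.ext fun v => ?_
  obtain ⟨s, rfl⟩ := (maximalIdeal _).toCotangent_surjective v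
  rfl

/-- **`dim_K X(K[ε])_x = dim_{κ(x)} 𝔪_x/𝔪_x²`**: the `K`-dimension of the tangent space of `(X, x)`'s functor of points
(Lemma 2.10's structure) is the embedding dimension at `x` — the currency of ★ `Dimension/SmoothRelativeDimensionOfClosedPoints`.
[cite: GortzWedhorn2020, (6.4) Prop. 6.7] [cite: Schlessinger1968, Lemma 2.10, p. 212] -/
theorem finrank_tangent_eq (π : letI := (stalkAlgebraMap F x).toAlgebra; X.presheaf.stalk x →ₐ[K] K) :
    letI := (stalkAlgebraMap F x).toAlgebra
    letI := (pointedSchemeFunctor F x).tangentAddCommGroup (basePointOfAugmentation F x π)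
      (pointedSchemeFunctor_base_eq F x _) K
      (pointedSchemeFunctor_isBijectiveAlong F x _ (ArtAlg.sqZeroExtAug_surjective K))
    letI := (pointedSchemeFunctor F x).tangentModule (basePointOfAugmentation F x π)
      (pointedSchemeFunctor_base_eq F x _) K
      (pointedSchemeFunctor_isBijectiveAlong F x _ (ArtAlg.sqZeroExtAug_surjective K))
    Module.finrank K ((pointedSchemeFunctor F x).obj (ArtAlg.sqZeroExt (k := K) K)) =
      Module.finrank (ResidueField (X.presheaf.stalk x)) (CotangentSpace (X.presheaf.stalk x)) := by
  letI := (stalkAlgebraMap F x).toAlgebra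
  letI := (pointedSchemeFunctor F x).tangentAddCommGroup (basePointOfAugmentation F x π)
    (pointedSchemeFunctor_base_eq F x _) K
    (pointedSchemeFunctor_isBijectiveAlong F x _ (ArtAlg.sqZeroExtAug_surjective K))
  letI := (pointedSchemeFunctor F x).tangentModule (basePointOfAugmentation F x π)
    (pointedSchemeFunctor_base_eq F x _) K
    (pointedSchemeFunctor_isBijectiveAlong F x _ (ArtAlg.sqZeroExtAug_surjective K))
  rw [← finrank_dual_cotangentSpace_eq π]
  exact (tangentLinearEquivDual F x π).finrank_eq

/-! ## §4 The junction for E1-mod: any functor of Artin rings naturally bijective with `(X, x)`'s functor of points -/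

section Junction

variable {D : ArtinFunctor.{u} K} (ν : ∀ R : ArtAlg.{u} K, D.obj R → (pointedSchemeFunctor F x).obj R)

/-- A functor `D` naturally bijective with `(X, x)`'s functor of points satisfies «(2.12) is a bijection» along surjections
(transfer, §1–§2). [cite: Schlessinger1968, Thm. 2.11 and (2.12), p. 212] -/
theorem isBijectiveAlong_of_isNatural_pointedSchemeFunctor (hν : D.IsNatural (pointedSchemeFunctor F x) ν)
    (hb : ∀ R, Function.Bijective (ν R)) {R₀ R₁ : ArtAlg.{u} K} (p : R₁ →ₐ[K] R₀) (hp : Function.Surjective p) :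
    D.IsBijectiveAlong p :=
  ArtinFunctor.IsBijectiveAlong.of_isNatural_bijective ν hν hb p (pointedSchemeFunctor_isBijectiveAlong F x p hp)

/-- Such a `D` takes the value «a point» on `K`. [cite: Schlessinger1968, Thm. 2.11, p. 212] -/
theorem base_eq_of_isNatural_pointedSchemeFunctor (hb : ∀ R, Function.Bijective (ν R)) (pt a : D.obj (ArtAlg.base K)) :
    a = pt :=
  (hb (ArtAlg.base K)).1 (pointedSchemeFunctor_base_eq F x _ _)

/-- **THE E1 JUNCTION.** If a functor of Artin rings `D` (e.g. the deformation functor `Def_{(A₀,λ₀,η₀)}` of the fibre at `x`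
of a universal family, E1-mod) is NATURALLY BIJECTIVE with `(X, x)`'s functor of points, `x` `K`-rational (augmentation `π`),
then its tangent space with [Schlessinger1968, Lemma 2.10]'s `K`-module structure is LINEARLY isomorphic to `(𝔪_x/𝔪_x²)^∨`:
`t_D ≃ₗ[K] Module.Dual K (CotangentSpace 𝒪_{X,x})` (`natTangentLinearEquiv` ≫ `tangentLinearEquivDual`).
[cite: GortzWedhorn2020, (6.4) Prop. 6.7] [cite: Schlessinger1968, (2.6) p. 211 and Lemma 2.10 p. 212] -/
def tangentLinearEquivDualOfNatural (hν : D.IsNatural (pointedSchemeFunctor F x) ν) (hb : ∀ R, Function.Bijective (ν R))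
    (π : letI := (stalkAlgebraMap F x).toAlgebra; X.presheaf.stalk x →ₐ[K] K) (ptD : D.obj (ArtAlg.base K)) :
    letI := (stalkAlgebraMap F x).toAlgebra
    letI := D.tangentAddCommGroup ptD (base_eq_of_isNatural_pointedSchemeFunctor F x ν hb ptD) K
      (isBijectiveAlong_of_isNatural_pointedSchemeFunctor F x ν hν hb _ (ArtAlg.sqZeroExtAug_surjective K))
    letI := D.tangentModule ptD (base_eq_of_isNatural_pointedSchemeFunctor F x ν hb ptD) K
      (isBijectiveAlong_of_isNatural_pointedSchemeFunctor F x ν hν hb _ (ArtAlg.sqZeroExtAug_surjective K))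
    D.obj (ArtAlg.sqZeroExt (k := K) K) ≃ₗ[K] Module.Dual K (CotangentSpace (X.presheaf.stalk x)) :=
  letI := (stalkAlgebraMap F x).toAlgebra
  letI := D.tangentAddCommGroup ptD (base_eq_of_isNatural_pointedSchemeFunctor F x ν hb ptD) K
    (isBijectiveAlong_of_isNatural_pointedSchemeFunctor F x ν hν hb _ (ArtAlg.sqZeroExtAug_surjective K))
  letI := D.tangentModule ptD (base_eq_of_isNatural_pointedSchemeFunctor F x ν hb ptD) K
    (isBijectiveAlong_of_isNatural_pointedSchemeFunctor F x ν hν hb _ (ArtAlg.sqZeroExtAug_surjective K))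
  letI := (pointedSchemeFunctor F x).tangentAddCommGroup (basePointOfAugmentation F x π)
    (pointedSchemeFunctor_base_eq F x _) K
    (pointedSchemeFunctor_isBijectiveAlong F x _ (ArtAlg.sqZeroExtAug_surjective K))
  letI := (pointedSchemeFunctor F x).tangentModule (basePointOfAugmentation F x π)
    (pointedSchemeFunctor_base_eq F x _) K
    (pointedSchemeFunctor_isBijectiveAlong F x _ (ArtAlg.sqZeroExtAug_surjective K))
  (ArtinFunctor.natTangentLinearEquiv ν hν hb ptD (base_eq_of_isNatural_pointedSchemeFunctor F x ν hb ptD)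
      (basePointOfAugmentation F x π) (pointedSchemeFunctor_base_eq F x _) K
      (isBijectiveAlong_of_isNatural_pointedSchemeFunctor F x ν hν hb _ (ArtAlg.sqZeroExtAug_surjective K))
      (pointedSchemeFunctor_isBijectiveAlong F x _ (ArtAlg.sqZeroExtAug_surjective K))).trans
    (tangentLinearEquivDual F x π)

/-- **`dim_K t_D = dim_{κ(x)} 𝔪_x/𝔪_x²`** for any functor of Artin rings `D` naturally bijective with `(X, x)`'s functor of points
— the shape in which the E-road's node E1 is consumed («tangent dimension of the deformation functor = embedding dimension of the
moduli scheme at the point»). [cite: GortzWedhorn2020, (6.4) Prop. 6.7] [cite: Schlessinger1968, Lemma 2.10, p. 212] -/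
theorem finrank_tangent_eq_of_isNatural (hν : D.IsNatural (pointedSchemeFunctor F x) ν) (hb : ∀ R, Function.Bijective (ν R))
    (π : letI := (stalkAlgebraMap F x).toAlgebra; X.presheaf.stalk x →ₐ[K] K) (ptD : D.obj (ArtAlg.base K)) :
    letI := D.tangentAddCommGroup ptD (base_eq_of_isNatural_pointedSchemeFunctor F x ν hb ptD) K
      (isBijectiveAlong_of_isNatural_pointedSchemeFunctor F x ν hν hb _ (ArtAlg.sqZeroExtAug_surjective K))
    letI := D.tangentModule ptD (base_eq_of_isNatural_pointedSchemeFunctor F x ν hb ptD) K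
      (isBijectiveAlong_of_isNatural_pointedSchemeFunctor F x ν hν hb _ (ArtAlg.sqZeroExtAug_surjective K))
    Module.finrank K (D.obj (ArtAlg.sqZeroExt (k := K) K)) =
      Module.finrank (ResidueField (X.presheaf.stalk x)) (CotangentSpace (X.presheaf.stalk x)) := by
  letI := (stalkAlgebraMap F x).toAlgebra
  letI := D.tangentAddCommGroup ptD (base_eq_of_isNatural_pointedSchemeFunctor F x ν hb ptD) K
    (isBijectiveAlong_of_isNatural_pointedSchemeFunctor F x ν hν hb _ (ArtAlg.sqZeroExtAug_surjective K))
  letI := D.tangentModule ptD (base_eq_of_isNatural_pointedSchemeFunctor F x ν hb ptD) K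
    (isBijectiveAlong_of_isNatural_pointedSchemeFunctor F x ν hν hb _ (ArtAlg.sqZeroExtAug_surjective K))
  rw [← finrank_dual_cotangentSpace_eq π]
  exact (tangentLinearEquivDualOfNatural F x ν hν hb π ptD).finrank_eq

end Junction

end Literature.AlgebraicGeometry.Deformation

end
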